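import Mathlib.Analysis.SpecialFunctions.Log.Deriv
import Mathlib.Analysis.SpecialFunctions.Pow.Real
import HarnessLib

/-!
# Ford's Lemma 4.3: the maximum of the exponents `E_j`

Topic `Literature/NumberTheory/LFunctions`. Everything here is PROVED.

K. Ford, Proc. LMS 85 (2002), **Lemma 4.3** bounds `max_{j ≥ 2} E_j` for the exponents `E_j`
of Lemma 4.2. With `α = 1 − 1/h`, `log P ≥ A`, `x = 4 log k/(Aηα) < 1`, one has
`E_j ≤ F(j)` where `F(z) = A(h − 1/h − αx + αz(x−1) − hα^z)`, and Ford shows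
`max_{z ≥ 2} F(z) ≤ (4 log k/η)[1 + h(1 + (1−x)log(1−x)/x)]`.

We prove the slightly sharper intermediate form, valid for **all real `z`** (tangent-line bound
for the convex `z ↦ α^z` at Ford's critical point (4.17)):

`F(z) ≤ A(h−1)[1/(4h²) + x(1 + 1/(2h−1)) + (1−x) log(1−x)]`  (`h ≥ 7`, `0 < x < 1`),

which is the penultimate display of Ford's proof (before his use of (4.18)); Ford's (4.18)
`x ≥ 1/(2h−1)` is off in the fourth digit, so the final absorption of the `1/(4h²)` term is
done by the user with whatever lower bound for `x` is available (Theorem 4 has `x ≥ 18/k`).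

## References

* K. Ford, Proc. London Math. Soc. (3) 85 (2002), 565–633, Lemma 4.3 and its proof,
  (4.16)–(4.18). [Ford2002]
-/

noncomputable section

open Real Finset

namespace Literature.NumberTheory.LFunctions
namespace FordVK

/-- Ford's comparison function `F(z) = A(h − 1/h − αx + αz(x−1) − hα^z)`, `α = 1 − 1/h`.
[cite: Ford2002, proof of Lemma 4.3] -/
def F43 (A h x z : ℝ) : ℝ :=
  A * (h - 1 / h - (1 - 1 / h) * x + (1 - 1 / h) * z * (x - 1) - h * (1 - 1 / h) ^ z)

/-! ### Bounds for `c = −h log α` -/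

/-- `−h log(1 − 1/h) ≥ 1`. [folklore] -/
theorem one_le_c {h : ℝ} (hh : 2 ≤ h) : 1 ≤ -h * Real.log (1 - 1 / h) := by
  have h0 : 0 < 1 - 1 / h := by
    have : 1 / h ≤ 1 / 2 := by rw [div_le_div_iff₀ (by linarith) (by norm_num)]; linarith
    linarith
  have h1 := Real.log_le_sub_one_of_pos h0
  have : h * Real.log (1 - 1 / h) ≤ h * (1 - 1 / h - 1) := mul_le_mul_of_nonneg_left h1 (by linarith)
  have e : h * (1 - 1 / h - 1) = -1 := by field_simp; ring
  linarith

/-- `−h log(1 − 1/h) ≤ 1 + 1/(2h) + 1/(3h²) + 1/(h²(h−1))` (from the Taylor remainder bound).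
[folklore] -/
theorem c_le {h : ℝ} (hh : 2 ≤ h) :
    -h * Real.log (1 - 1 / h) ≤ 1 + 1 / (2 * h) + 1 / (3 * h ^ 2) + 1 / (h ^ 2 * (h - 1)) := by
  have hpos : 0 < h := by linarith
  set u : ℝ := 1 / h with hu
  have hu0 : 0 < u := by positivity
  have hu1 : u ≤ 1 / 2 := by
    rw [hu, div_le_div_iff₀ (by linarith) (by norm_num)]; linarith
  have habs : |u| < 1 := by rw [abs_of_pos hu0]; linarith
  have h1 := Real.abs_log_sub_add_sum_range_le habs 3
  simp only [Finset.sum_range_succ, Finset.sum_range_zero, abs_of_pos hu0] at h1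
  norm_num at h1
  have h2 := (abs_le.1 h1).1
  -- h2 : -(u^4/(1-u)) ≤ u + u^2/2 + u^3/3 + log(1-u)
  have h1u : 0 < 1 - u := by linarith
  have h3 : -h * Real.log (1 - u) ≤ h * (u + u ^ 2 / 2 + u ^ 3 / 3) + h * (u ^ 4 / (1 - u)) := by
    nlinarith
  refine h3.trans (le_of_eq ?_)
  have hm1 : h - 1 ≠ 0 := ne_of_gt (by linarith)
  have e : h * (u + u ^ 2 / 2 + u ^ 3 / 3) + h * (u ^ 4 / (1 - u))
      = 1 + 1 / (2 * h) + 1 / (3 * h ^ 2) + 1 / (h ^ 2 * (h - 1)) := by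
    rw [hu]
    field_simp
  exact e

/-- `−h log(1 − 1/h) ≤ 1 + 1/(2h) + 1/(2h(h−1)) = (2h−1)/(2h−2)` for `h ≥ 4`. [cite: Ford2002, proof of
Lemma 4.3 ("−h log α ≤ 1 + 1/(2h−2)")] -/
theorem c_le' {h : ℝ} (hh : 4 ≤ h) : -h * Real.log (1 - 1 / h) ≤ 1 + 1 / (2 * h) + 1 / (2 * h * (h - 1)) := by
  refine (c_le (by linarith)).trans ?_
  have hpos : 0 < h := by linarith
  have hm1 : 0 < h - 1 := by linarith
  have key : 1 / (3 * h ^ 2) + 1 / (h ^ 2 * (h - 1)) ≤ 1 / (2 * h * (h - 1)) := by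
    have e : 1 / (3 * h ^ 2) + 1 / (h ^ 2 * (h - 1)) = (h + 2) / (3 * h ^ 2 * (h - 1)) := by
      field_simp; ring
    rw [e, div_le_div_iff₀ (by positivity) (by positivity)]
    have h4 : 0 ≤ h - 4 := by linarith
    have := mul_nonneg (mul_nonneg (mul_nonneg hpos.le hpos.le) hm1.le) h4
    nlinarith
  linarith

/-! ### The tangent-line bound and the value at the critical point -/

/-- **Lemma 4.3, core form**: for all real `z`,
`F(z) ≤ A(h−1)[x + (1−x)(1 − (1 + log c − log(1−x))/c)]`, `c = −h log(1−1/h)`.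
[cite: Ford2002, proof of Lemma 4.3 ("F(y) = A(h−1)(x+(1−x)V)")] -/
theorem F43_le_crit {A h x : ℝ} (hA : 0 ≤ A) (hh : 2 ≤ h) (hx0 : 0 < x) (hx1 : x < 1) (z : ℝ) :
    F43 A h x z ≤ A * (h - 1) * (x + (1 - x) *
      (1 - (1 + Real.log (-h * Real.log (1 - 1 / h)) - Real.log (1 - x)) / (-h * Real.log (1 - 1 / h)))) := by
  set α : ℝ := 1 - 1 / h with hα
  have hpos : 0 < h := by linarith
  have hα0 : 0 < α := by
    have : 1 / h ≤ 1 / 2 := by rw [div_le_div_iff₀ (by linarith) (by norm_num)]; linarith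
    rw [hα]; linarith
  have h1h : 0 < 1 / h := by positivity
  have hα1 : α < 1 := by rw [hα]; linarith
  have hlogα : Real.log α < 0 := Real.log_neg hα0 hα1
  set c : ℝ := -h * Real.log α with hc
  have hc1 : 1 ≤ c := one_le_c hh
  have hc0 : 0 < c := by linarith
  -- the critical point `y`: `α^y = α(1−x)/c`
  set w : ℝ := α * (1 - x) / c with hw
  have hw0 : 0 < w := by rw [hw]; exact div_pos (mul_pos hα0 (by linarith)) hc0
  set y : ℝ := Real.log w / Real.log α with hy
  have hαy : α ^ y = w := by
    rw [Real.rpow_def_of_pos hα0, hy, mul_div_cancel₀ _ hlogα.ne, Real.exp_log hw0]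
  -- convexity: `α^z ≥ α^y (1 + (z − y) log α)`
  have hconv : α ^ y * (1 + (z - y) * Real.log α) ≤ α ^ z := by
    rw [Real.rpow_def_of_pos hα0, Real.rpow_def_of_pos hα0]
    have := Real.add_one_le_exp ((z - y) * Real.log α)
    have e : Real.exp (Real.log α * z) = Real.exp (Real.log α * y) * Real.exp ((z - y) * Real.log α) := by
      rw [← Real.exp_add]; ring_nf
    rw [e]
    exact mul_le_mul_of_nonneg_left (by linarith) (Real.exp_pos _).le
  -- main estimate
  have hF : F43 A h x z = A * (h - 1 / h - α * x + α * z * (x - 1) - h * α ^ z) := rfl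
  rw [hF]
  have step1 : h - 1 / h - α * x + α * z * (x - 1) - h * α ^ z
      ≤ h - 1 / h - α * x + α * z * (x - 1) - h * (α ^ y * (1 + (z - y) * Real.log α)) := by
    have := mul_le_mul_of_nonneg_left hconv hpos.le
    linarith
  -- substitute `α^y = w = α(1−x)/c` and `h log α = −c`
  have step2 : h - 1 / h - α * x + α * z * (x - 1) - h * (α ^ y * (1 + (z - y) * Real.log α))
      = h - 1 / h - α * x - h * w - α * (1 - x) * y := by
    rw [hαy]
    have e_w : c * w = α * (1 - x) := by rw [hw, ← mul_div_assoc, mul_div_cancel_left₀ _ hc0.ne']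
    have e_c : c = -h * Real.log α := hc
    linear_combination (z - y) * e_w - (z - y) * w * e_c
  -- compute `y = 1 + h (log c − log(1−x))/c`? we only need `α(1−x) y` : use `y log α = log w`
  have hylog : y * Real.log α = Real.log w := by rw [hy, div_mul_cancel₀ _ hlogα.ne]
  have hlogw : Real.log w = Real.log α + Real.log (1 - x) - Real.log c := by
    rw [hw, Real.log_div (mul_pos hα0 (by linarith)).ne' hc0.ne', Real.log_mul hα0.ne' (by linarith)]
  -- `y = (log α + log(1−x) − log c)/log α = 1 − h(log(1−x) − log c)/c`... via `1/log α = −h/c`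
  have hlog0 : Real.log α ≠ 0 := hlogα.ne
  have hy' : y = 1 + h * (Real.log c - Real.log (1 - x)) / c := by
    have : y = Real.log w / Real.log α := hy
    rw [this, hlogw, hc]
    field_simp
    ring
  have step3 : h - 1 / h - α * x - h * w - α * (1 - x) * y
      = (h - 1) * (x + (1 - x) * (1 - (1 + Real.log c - Real.log (1 - x)) / c)) := by
    rw [hy', hw, hα]
    field_simp
    ring
  calc A * (h - 1 / h - α * x + α * z * (x - 1) - h * α ^ z)
      ≤ A * (h - 1 / h - α * x + α * z * (x - 1) - h * (α ^ y * (1 + (z - y) * Real.log α))) :=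
        mul_le_mul_of_nonneg_left step1 hA
    _ = A * ((h - 1) * (x + (1 - x) * (1 - (1 + Real.log c - Real.log (1 - x)) / c))) := by rw [step2, step3]
    _ = _ := by rw [hc, hα]; ring

/-- **Bound for `V`**: `1 − (1 + log c − log(1−x))/c ≤ 1/(4h²) + ((2h−2)/(2h−1)) log(1−x)` for `h ≥ 7`,
`0 < x < 1`. [cite: Ford2002, proof of Lemma 4.3 ("V ≤ 1/(4h²) + (2h−2)/(2h−1) log(1−x)")] -/
theorem V_le {h x : ℝ} (hh : 7 ≤ h) (hx0 : 0 < x) (hx1 : x < 1) :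
    1 - (1 + Real.log (-h * Real.log (1 - 1 / h)) - Real.log (1 - x)) / (-h * Real.log (1 - 1 / h))
      ≤ 1 / (4 * h ^ 2) + (2 * h - 2) / (2 * h - 1) * Real.log (1 - x) := by
  set c : ℝ := -h * Real.log (1 - 1 / h) with hc
  have hc1 : 1 ≤ c := one_le_c (by linarith)
  have hc0 : 0 < c := by linarith
  have hcle : c ≤ 1 + 1 / (2 * h) + 1 / (2 * h * (h - 1)) := c_le' (by linarith)
  have hpos : 0 < h := by linarith
  have hm1 : 0 < h - 1 := by linarith
  -- split: `1 − (1 + log c)/c − (−log(1−x))/c`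
  have hlog1x : Real.log (1 - x) ≤ 0 := Real.log_nonpos (by linarith) (by linarith)
  have e0 : 1 - (1 + Real.log c - Real.log (1 - x)) / c = (c - 1 - Real.log c) / c + Real.log (1 - x) / c := by
    field_simp; ring
  rw [e0]
  -- first part: `(c − 1 − log c)/c ≤ c − 1 − log c ≤ v²/2 ≤ 1/(4h²)` with `v = c − 1`
  set v := c - 1 with hv
  have hv0 : 0 ≤ v := by linarith
  have hvle : v ≤ 1 / (2 * h) + 1 / (2 * h * (h - 1)) := by linarith
  have hlogc : v - v ^ 2 / 2 ≤ Real.log c := by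
    have h1 := Real.le_log_one_add_of_nonneg hv0
    rw [show (1 : ℝ) + v = c by rw [hv]; ring] at h1
    have h2 : v - v ^ 2 / 2 ≤ 2 * v / (v + 2) := by
      rw [le_div_iff₀ (by linarith)]; nlinarith [sq_nonneg v, mul_nonneg hv0 (sq_nonneg v)]
    linarith
  have part1 : (c - 1 - Real.log c) / c ≤ 1 / (4 * h ^ 2) := by
    have h1 : (c - 1 - Real.log c) / c ≤ c - 1 - Real.log c := by
      rw [div_le_iff₀ hc0]
      have : 0 ≤ c - 1 - Real.log c := by have := Real.log_le_sub_one_of_pos hc0; linarith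
      nlinarith
    have h2 : c - 1 - Real.log c ≤ v ^ 2 / 2 := by rw [hv] at hlogc ⊢; linarith
    have h3 : v ^ 2 / 2 ≤ 1 / (4 * h ^ 2) := by
      -- `v ≤ 1/(2(h−1))` hence `v² ≤ 1/(4(h−1)²)` and `1/(8(h-1)^2) ≤ 1/(4h²)` for `h ≥ 4`
      have hv' : v ≤ 1 / (2 * (h - 1)) := by
        refine hvle.trans (le_of_eq ?_); field_simp; ring
      have hv2 : v ^ 2 ≤ (1 / (2 * (h - 1))) ^ 2 := pow_le_pow_left₀ hv0 hv' 2
      have : (1 / (2 * (h - 1))) ^ 2 / 2 ≤ 1 / (4 * h ^ 2) := by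
        rw [div_pow, one_pow, div_div, div_le_div_iff₀ (by positivity) (by positivity)]
        nlinarith
      linarith
    linarith
  -- second part: `log(1−x)/c ≤ ((2h−2)/(2h−1)) log(1−x)` since `1/c ≥ (2h−2)/(2h−1)` and `log(1−x) ≤ 0`
  have part2 : Real.log (1 - x) / c ≤ (2 * h - 2) / (2 * h - 1) * Real.log (1 - x) := by
    have hinv : (2 * h - 2) / (2 * h - 1) ≤ 1 / c := by
      rw [div_le_div_iff₀ (by linarith) hc0]
      have : c * (2 * h - 2) ≤ 2 * h - 1 := by
        have e : (1 + 1 / (2 * h) + 1 / (2 * h * (h - 1))) * (2 * h - 2) = 2 * h - 1 := by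
          field_simp; ring
        nlinarith
      linarith
    rw [div_eq_mul_one_div, mul_comm]
    exact mul_le_mul_of_nonpos_right hinv hlog1x
  linarith

/-- **Ford's Lemma 4.3** (corrected intermediate form, all real `z`): for `h ≥ 7`, `A ≥ 0`,
`0 < x < 1`, `F(z) ≤ A(h−1)[1/(4h²) + x(1 + 1/(2h−1)) + (1−x) log(1−x)]`.
[cite: Ford2002, Lemma 4.3 (penultimate display of the proof)] -/
theorem ford_lemma43 {A h x : ℝ} (hA : 0 ≤ A) (hh : 7 ≤ h) (hx0 : 0 < x) (hx1 : x < 1) (z : ℝ) :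
    F43 A h x z ≤ A * (h - 1) * (1 / (4 * h ^ 2) + x * (1 + 1 / (2 * h - 1)) + (1 - x) * Real.log (1 - x)) := by
  have h1 := F43_le_crit (h := h) hA (by linarith) hx0 hx1 z
  have h2 := V_le hh hx0 hx1
  have hm1 : 0 ≤ A * (h - 1) := mul_nonneg hA (by linarith)
  refine h1.trans ?_
  refine mul_le_mul_of_nonneg_left ?_ hm1
  have h3 : (1 - x) * (1 - (1 + Real.log (-h * Real.log (1 - 1 / h)) - Real.log (1 - x)) / (-h * Real.log (1 - 1 / h)))
      ≤ (1 - x) * (1 / (4 * h ^ 2) + (2 * h - 2) / (2 * h - 1) * Real.log (1 - x)) :=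
    mul_le_mul_of_nonneg_left h2 (by linarith)
  -- `(1−x)·[1/(4h²) + (1 − 1/(2h−1)) log(1−x)] ≤ 1/(4h²) + (1−x)log(1−x) + x/(2h−1)`
  have hlog1x : Real.log (1 - x) ≤ 0 := Real.log_nonpos (by linarith) (by linarith)
  have hxl : -x ≤ (1 - x) * Real.log (1 - x) := by
    -- `log(1−x) ≥ 1 − 1/(1−x)` i.e. `(1−x) log(1−x) ≥ (1−x) − 1 = −x`
    have := Real.one_sub_inv_le_log_of_pos (show 0 < 1 - x by linarith)
    have h' : (1 - x) * (1 - (1 - x)⁻¹) ≤ (1 - x) * Real.log (1 - x) := mul_le_mul_of_nonneg_left this (by linarith)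
    have h1x0 : 1 - x ≠ 0 := ne_of_gt (by linarith)
    have e : (1 - x) * (1 - (1 - x)⁻¹) = -x := by field_simp; ring
    linarith
  have h2h : 0 < 2 * h - 1 := by linarith
  have e1 : (2 * h - 2) / (2 * h - 1) = 1 - 1 / (2 * h - 1) := by field_simp; ring
  rw [e1] at h3
  set Lg := Real.log (1 - x) with hLg
  have h4 : (1 - x) * (1 / (4 * h ^ 2) + (1 - 1 / (2 * h - 1)) * Lg)
      ≤ 1 / (4 * h ^ 2) + (1 - x) * Lg + x * (1 / (2 * h - 1)) := by
    have expand : (1 - x) * (1 / (4 * h ^ 2) + (1 - 1 / (2 * h - 1)) * Lg)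
        = (1 - x) * (1 / (4 * h ^ 2)) + (1 - x) * Lg - (1 / (2 * h - 1)) * ((1 - x) * Lg) := by ring
    have t1 : (1 - x) * (1 / (4 * h ^ 2)) ≤ 1 / (4 * h ^ 2) := by
      have : 0 ≤ x * (1 / (4 * h ^ 2)) := by positivity
      linarith
    have hc0 : 0 ≤ 1 / (2 * h - 1) := by positivity
    have t2 : -((1 / (2 * h - 1)) * ((1 - x) * Lg)) ≤ x * (1 / (2 * h - 1)) := by
      have := mul_le_mul_of_nonneg_left hxl hc0
      linarith
    linarith
  linarith

/-! ### The numerical consequence used in Theorem 4 -/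

/-- `(1−x) log(1−x) ≤ −x + 0.59 x²` for `0 ≤ x ≤ 0.41`. (Ford: `≤ −x + 0.5866x²` on `[0, 0.408]`.)
[cite: Ford2002, proof of Theorem 4 ("1 + (1−x)log(1−x)/x = x/2 + x²/6 + ⋯ ≤ 0.5866x")] -/
theorem one_sub_mul_log_le {x : ℝ} (hx0 : 0 ≤ x) (hx1 : x ≤ 0.41) :
    (1 - x) * Real.log (1 - x) ≤ -x + 0.59 * x ^ 2 := by
  rcases eq_or_lt_of_le hx0 with rfl | hx0'
  · simp
  have habs : |x| < 1 := by rw [abs_of_pos hx0']; linarith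
  have h1 := Real.abs_log_sub_add_sum_range_le habs 8
  simp only [Finset.sum_range_succ, Finset.sum_range_zero, abs_of_pos hx0'] at h1
  norm_num at h1
  have h2 := (abs_le.1 h1).2
  -- h2 : x + x²/2 + ⋯ + x⁸/8 + log(1−x) ≤ x⁹/(1−x)
  have h1x : 0 < 1 - x := by linarith
  have h3 : (1 - x) * Real.log (1 - x)
      ≤ (1 - x) * (x ^ 9 / (1 - x) - (x + x ^ 2 / 2 + x ^ 3 / 3 + x ^ 4 / 4 + x ^ 5 / 5 + x ^ 6 / 6
          + x ^ 7 / 7 + x ^ 8 / 8)) := mul_le_mul_of_nonneg_left (by linarith) h1x.le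
  have e : (1 - x) * (x ^ 9 / (1 - x) - (x + x ^ 2 / 2 + x ^ 3 / 3 + x ^ 4 / 4 + x ^ 5 / 5 + x ^ 6 / 6
          + x ^ 7 / 7 + x ^ 8 / 8))
      = -x + x ^ 2 * (1 / 2 + x / 6 + x ^ 2 / 12 + x ^ 3 / 20 + x ^ 4 / 30 + x ^ 5 / 42 + x ^ 6 / 56)
        + 9 / 8 * x ^ 9 := by
    field_simp
    ring
  rw [e] at h3
  refine h3.trans ?_
  -- `1/2 + x/6 + ⋯ + x⁶/56 + (9/8)x⁷ ≤ 0.59` on `[0, 0.41]`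
  have p1 : x ≤ 0.41 := hx1
  have p2 : x ^ 2 ≤ 0.41 ^ 2 := pow_le_pow_left₀ hx0 hx1 2
  have p3 : x ^ 3 ≤ 0.41 ^ 3 := pow_le_pow_left₀ hx0 hx1 3
  have p4 : x ^ 4 ≤ 0.41 ^ 4 := pow_le_pow_left₀ hx0 hx1 4
  have p5 : x ^ 5 ≤ 0.41 ^ 5 := pow_le_pow_left₀ hx0 hx1 5
  have p6 : x ^ 6 ≤ 0.41 ^ 6 := pow_le_pow_left₀ hx0 hx1 6
  have p7 : x ^ 7 ≤ 0.41 ^ 7 := pow_le_pow_left₀ hx0 hx1 7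
  have hq : 1 / 2 + x / 6 + x ^ 2 / 12 + x ^ 3 / 20 + x ^ 4 / 30 + x ^ 5 / 42 + x ^ 6 / 56 + 9 / 8 * x ^ 7
      ≤ 0.59 := by
    norm_num at p2 p3 p4 p5 p6 p7 ⊢
    linarith
  have hx2 : 0 ≤ x ^ 2 := sq_nonneg x
  have := mul_le_mul_of_nonneg_left hq hx2
  nlinarith

/-- **Lemma 4.3 + Theorem 4 numerics**: for `h ≥ 7`, `A ≥ 0`, `x₀ ≤ x ≤ 0.41`, `0 < x₀`, all real `z`:
`F(z) ≤ A(h−1)x[1/(4h²x₀) + 1/(2h−1) + 0.59x]`. [cite: Ford2002, Lemma 4.3 and proof of Theorem 4] -/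
theorem ford_lemma43' {A h x x₀ : ℝ} (hA : 0 ≤ A) (hh : 7 ≤ h) (hx₀ : 0 < x₀) (hx0 : x₀ ≤ x) (hx1 : x ≤ 0.41)
    (z : ℝ) :
    F43 A h x z ≤ A * (h - 1) * x * (1 / (4 * h ^ 2 * x₀) + 1 / (2 * h - 1) + 0.59 * x) := by
  have hx : 0 < x := lt_of_lt_of_le hx₀ hx0
  have h1 := ford_lemma43 hA hh hx (by linarith) z
  have h2 := one_sub_mul_log_le hx.le hx1
  have hm1 : 0 ≤ A * (h - 1) := mul_nonneg hA (by linarith)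
  refine h1.trans ?_
  rw [mul_assoc (A * (h - 1)) x]
  refine mul_le_mul_of_nonneg_left ?_ hm1
  have h3 : 1 / (4 * h ^ 2) ≤ x * (1 / (4 * h ^ 2 * x₀)) := by
    rw [mul_one_div, le_div_iff₀ (by positivity), div_mul_eq_mul_div, one_mul, div_le_iff₀ (by positivity)]
    nlinarith [sq_nonneg h]
  nlinarith

end FordVK
end Literature.NumberTheory.LFunctions
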